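import Summits.BirchSwinnertonDyer.Rank1Residual.P2.WindowsAtTwo
import Literature.NumberTheory.EllipticCurves.CaiLiZhai2019.TwoPartBSDQuadraticTwists
import Literature.NumberTheory.EllipticCurves.Rank1Residual.ClassX1KellerYinCertificate
import Literature.NumberTheory.EllipticCurves.KrizLi2019.TwoPartBSDTwists
import Literature.NumberTheory.EllipticCurves.GlobalMinimalModelProofs
import HarnessLib

/-!
# Sub-lane «bsd-p2»: TRANSPORT AT `2` — the P2 consumer of the as-printed quadratic-twist records:
# Cai–Li–Zhai 2020 Thm 1.1 / 1.5 ⇒ `BSD(E^{(M)}, 2)` from a CERTIFIED BASE `BSD(E, 2)`, as a pair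
# statement and as a twist-family class statement

HONEST FRAMING (sub-lane «bsd-p2», run/shared/lean/b2b/bsd-rank1-residual/p2/, verbatim in every
file): the target of record is the FULL Birch–Swinnerton-Dyer formula for EVERY analytic-rank `≤ 1`
`E/ℚ` at ALL primes INCLUDING `2`; the odd-prime class ledger is referee A's; the `2`-part is OPEN
(cells O1 = X5 ∖ CM and O12 = the CM corner) and under census by «bsd-p2». Census / instrument
output at `2` = EVIDENCE / conjecture items with held-out validation, NEVER a Literature fact;
certificates close PAIRS (one isogeny class, `p = 2`), never classes. This file asserts NO
arithmetic fact: its inputs are the AS-PRINTED named facts of p2-lit-1's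
`CaiLiZhai2019/TwoPartBSDQuadraticTwists.lean` (p310175; `thm11_ord_two_LAlg_twist`,
`thm15_twoPartBSD_twist`, nothing asserted), modularity (`hasEntireLFunction_rat`),
Gross–Zagier–Kolyvagin (`rank_eq_analyticRank_of_analyticRank_le_one`), and a CERTIFIED-BASE
hypothesis `BSDp W 2` for the curve being twisted — all explicit binders. The lead's census word
for a pair closed this way is `TRANSPORTED:<thm>:<base>:<d>` (LEAD-OKS I2-2), DISTINCT from
`CERTIFIED`; this file is its kernel shape. Nothing booked; no mark moved. Unit
`b2b-bsdres-p2-typer` (LEAD-OKS L-OW: "the typer's F4 becomes the P2 CONSUMER"; T-5′: the Kriz–Li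
file of record is p2-lit-2's `KrizLi2019/TwoPartBSDTwists.lean`, p310634). Shu–Zhai 2021 / Zhai
2021 are appended when their as-printed files land.

## Contents

* §1 BRIDGE: Cai–Li–Zhai's printed currency `CaiLiZhai2019.pPartBSD V p` ("the `p`-part of (fbsd)":
  `L^{(r)}/(r!) = q·Ω·R`, `ord_p q = ord_p(∏c_ℓ·#Ш/#E_tor²)`) IS the cell's print shape `PPart V p`
  (`ord_p q = ord_p #Ш + ord_p ∏c_ℓ − 2 ord_p #E_tor`) when `Ш` is finite (`pPartBSD_iff_pPart`);
  hence ⟺ Miller's `BSDp V p` in analytic rank `≤ 1` via the tree's `bsdp_of_pPart` / `pPart_of_bsdp`.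
* §2 PAIR FORM `bsdp_two_twist_of_caiLiZhai`: CLZ Thm 1.5's hypotheses verbatim as binders (optimal
  datum with odd Manin constant, `#E(ℚ)[2] = 2`, `ord₂(L(E,1)/Ω_E) = −1`, `M = ∏ Q`, `Q ⊆ 𝒮` nonempty,
  `Ш(E′)[2] = 0` for the `2`-isogenous `E′`, every `ℓ ∣ 2C` split in `ℚ(√M)`) + `BSDp W 2` (the
  certified base) ⇒ `BSDp WM 2` for any globally minimal model `WM` of `E^{(M)}`; both `E` and
  `E^{(M)}` have analytic rank `0` (Thm 1.1).
* §3 FAMILY FORM `bsdTwoOn_twistFamily_caiLiZhai`: for a fixed base `E` with the base-side hypotheses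
  and `BSDp W 2`, the class `TwistFamilyAtTwo W S_CLZ` (parameters `d = ∏ Q` with the `Q`-side
  conditions) has its BSD-at-2 statement — a CLOSED one-parameter family INSIDE the open O1 rank-`0`
  cells (the twists are rank `0`; image / reduction bits are not pinned here), conditional on the
  base pair's certificate: it never recolours a cell.
* §4 KRIZ–LI 2019 (FMS 7, Thm 5.1 (2) = arXiv Thm 1.12; p2-lit-2's `KrizLi2019.thm112_bsdTwo_twist`,
  typed directly in `BSDp` currency): PAIR FORM `bsdp_two_twists_of_krizLi` (hypotheses verbatim:
  `E(ℚ)[2] = 0`, Heegner `K` with `2` split and (★), `c₂` odd, odd Manin constant if additive at `2`;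
  TWO certified bases `BSDp W 2` and `BSDp W₀ 2` for `E` and `E^{(d_K)}`; `d ∈ 𝒩` with `ψ_d(−N) = 1`
  ⇒ `BSDp` of `E^{(d)}` and `E^{(d·d_K)}`), the orientation flip `exists_smul_eq_comm` between the two
  twist conventions in the tree, and the `X5.O1.TwistTransportAtTwo`-DIRECTION statement
  `missingPPartAt_twist_of_krizLi` (T-5′): KL delivers the FORWARD half base ⇒ twist of O1's iff
  schema; the converse (twist ⇒ base) is not printed and is not claimed.

References: Cai–Li–Zhai, J. LMS 101 (2020) Thm 1.1, Thm 1.5 [CaiLiZhai2019]; Kriz–Li, FMS 7 (2019)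
Thm 5.1 / arXiv Thm 1.12 [KrizLi2019]; Miller 2011 Def 1.1 [Miller2011LMS]; Yan–Zhu 2026 Thm 4.15
display (print shape) [YanZhu2026]; Silverman AEC VIII.8 Cor 8.3 (global minimal models)
[SilvermanAEC2009]; HOME/p2/LEAD-OKS.md I2-1/I2-2/L-OW/T-5′; HOME/p2/idea-2/ROUTES.md T1.
-/

noncomputable section

open scoped Classical MatrixGroups ModularForm

open CongruenceSubgroup NumberField WeierstrassCurve Literature.NumberTheory.EllipticCurves
  Literature.NumberTheory.EllipticCurves.ModularForms
  Literature.NumberTheory.EllipticCurves.Rank1Residual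
  Literature.NumberTheory.EllipticCurves.Rank1Residual.Typed

set_option autoImplicit false

namespace Summit.BirchSwinnertonDyer.Rank1Residual.P2

/-! ## §1 The bridge between Cai–Li–Zhai's printed currency and the cell's print shape -/

/-- The valuation identity behind the bridge: for positive naturals `c, s, t`,
`ord_p (c·s/t²) = ord_p s + ord_p c − 2·ord_p t`. [folklore] -/
theorem padicValRat_tamagawa_sha_torsion (p : ℕ) [Fact p.Prime] {c s t : ℕ} (hc : 0 < c)
    (hs : 0 < s) (ht : 0 < t) :
    padicValRat p ((c : ℚ) * s / (t : ℚ) ^ 2) =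
      (padicValNat p s : ℤ) + padicValNat p c - 2 * padicValNat p t := by
  have hc' : (c : ℚ) ≠ 0 := by exact_mod_cast hc.ne'
  have hs' : (s : ℚ) ≠ 0 := by exact_mod_cast hs.ne'
  have ht' : (t : ℚ) ≠ 0 := by exact_mod_cast ht.ne'
  rw [padicValRat.div (mul_ne_zero hc' hs') (pow_ne_zero 2 ht'), padicValRat.mul hc' hs',
    padicValRat.pow (t : ℚ), padicValRat.of_nat, padicValRat.of_nat, padicValRat.of_nat]
  ring

/-- **BRIDGE.** For an elliptic `V/ℚ` with FINITE `Ш`, Cai–Li–Zhai's "the `p`-part of (fbsd) holds"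
(`CaiLiZhai2019.pPartBSD V p`: `L^{(r)}(E,1)/r! = q·Ω(E)·R(E)` with
`ord_p q = ord_p(∏ c_ℓ · #Ш / #E(ℚ)_tor²)`) is EQUIVALENT to the cell's print shape `PPart V p`
(`L^{(r)}(E,1)/(r!·Ω·R) = q` with `ord_p q = ord_p #Ш + ord_p ∏ c_ℓ − 2·ord_p #E(ℚ)_tor`) — the same
rational `q` (`Ω > 0`, `R > 0`), the same valuation (`#Ш, ∏ c_ℓ, #E_tor > 0`).
[cite: CaiLiZhai2019, §1 (fbsd) (arXiv:1712.01271 chunk p0003 L3–L11)] [cite: YanZhu2026, Thm. 4.15 (display)] -/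
theorem pPartBSD_iff_pPart (V : WeierstrassCurve ℚ) [V.IsElliptic] [Finite V.sha] (p : ℕ)
    [Fact p.Prime] : CaiLiZhai2019.pPartBSD V p ↔ PPart V p := by
  have hΩ : (0 : ℝ) < V.realPeriodRat := V.realPeriodRat_pos_holds
  have hR : (0 : ℝ) < V.regulator := V.regulator_pos'
  have hc : 0 < V.tamagawaProduct := V.tamagawaProduct_pos_holds
  have ht : 0 < V.torsionOrder := V.torsionOrder_pos_holds
  have hs : 0 < V.shaOrder := by
    unfold WeierstrassCurve.shaOrder
    exact Nat.card_pos
  have hΩ' : (V.realPeriodRat : ℂ) ≠ 0 := by exact_mod_cast hΩ.ne'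
  have hR' : (V.regulator : ℂ) ≠ 0 := by exact_mod_cast hR.ne'
  have hval := padicValRat_tamagawa_sha_torsion p hc hs ht
  have hcast : (((V.realPeriodRat * V.regulator : ℝ)) : ℂ) = (V.realPeriodRat : ℂ) * (V.regulator : ℂ) := by
    push_cast; rfl
  constructor
  · rintro ⟨q, hq, hv⟩
    refine ⟨q, ?_, by rw [hv, hval]⟩
    rw [hcast, hq]
    field_simp
  · rintro ⟨q, hq, hv⟩
    refine ⟨q, ?_, by rw [hv, hval]⟩
    rw [hcast] at hq
    rw [← hq]
    field_simp

/-- Bridge to Miller's currency, forward: in analytic rank `≤ 1` (GZK `hGZK`, modularity `hmod`),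
`CaiLiZhai2019.pPartBSD V 2 → BSDp V 2`. [cite: Miller2011LMS, §1 and Def. 1.1] -/
theorem bsdp_two_of_pPartBSD (hmod : hasEntireLFunction_rat)
    (hGZK : rank_eq_analyticRank_of_analyticRank_le_one) (V : WeierstrassCurve ℚ) [V.IsElliptic]
    [V.IsGloballyMinimal] (hr : V.analyticRank ≤ 1) (h : CaiLiZhai2019.pPartBSD V 2) : BSDp V 2 := by
  haveI : Finite V.sha := (hGZK V hr).2
  exact bsdp_of_pPart V 2 hmod hGZK hr ((pPartBSD_iff_pPart V 2).1 h)

/-- Bridge, backward: `BSDp V 2 → CaiLiZhai2019.pPartBSD V 2` in analytic rank `≤ 1`.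
[cite: Miller2011LMS, §1 and Def. 1.1] -/
theorem pPartBSD_two_of_bsdp (hmod : hasEntireLFunction_rat)
    (hGZK : rank_eq_analyticRank_of_analyticRank_le_one) (V : WeierstrassCurve ℚ) [V.IsElliptic]
    [V.IsGloballyMinimal] (hr : V.analyticRank ≤ 1) (h : BSDp V 2) : CaiLiZhai2019.pPartBSD V 2 := by
  haveI : Finite V.sha := (hGZK V hr).2
  exact (pPartBSD_iff_pPart V 2).2 (pPart_of_bsdp hmod hGZK V 2 hr h)

/-! ## §2 Cai–Li–Zhai 2020 Thm 1.1 / 1.5 at `2`: the pair form -/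

section CLZ

variable {W : WeierstrassCurve ℚ} [W.IsElliptic] [W.IsGloballyMinimal] [NeZero (W.conductorNorm ℤ)]

omit [W.IsGloballyMinimal] [NeZero (W.conductorNorm ℤ)] in
/-- Under Cai–Li–Zhai's hypothesis `ord₂(L(E,1)/Ω_E) = −1`, `L(E,1) ≠ 0`, so `E` has analytic rank
`0` (modularity). [cite: CaiLiZhai2019, Thm. 1.1 hypothesis (2)] -/
theorem analyticRank_eq_zero_of_ord_two_LAlg (hmod : hasEntireLFunction_rat)
    (hL : ∃ q : ℚ, W.entireLFunction 1 = (q : ℂ) * (W.realPeriodRat : ℂ) ∧ padicValRat 2 q = -1) :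
    W.analyticRank = 0 := by
  obtain ⟨q, hq, hv⟩ := hL
  have hq0 : q ≠ 0 := by
    rintro rfl
    simp at hv
  have hΩ : (W.realPeriodRat : ℂ) ≠ 0 := by exact_mod_cast W.realPeriodRat_pos_holds.ne'
  have hLne : W.entireLFunction 1 ≠ 0 := by
    rw [hq]; exact mul_ne_zero (by exact_mod_cast hq0) hΩ
  exact (W.analyticRank_eq_zero_iff_holds (hmod W)).mpr hLne

/-- **`BSD(E^{(M)}, 2)` FROM A CERTIFIED BASE `BSD(E, 2)` (Cai–Li–Zhai 2020 Thm 1.1 + 1.5 at `2`,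
pair form).** Hypotheses VERBATIM as typed by p2-lit-1 (binders): `E` optimal with odd Manin
constant (datum `D`), `#E(ℚ)[2] = 2`, `ord₂(L(E,1)/Ω_E) = −1`, `Q ⊆ 𝒮` nonempty with `M = ∏ Q`,
`WM` a globally minimal model of `E^{(M)}`, `Ш(E′)[2] = 0` for the `2`-isogenous `E′`, every `ℓ ∣ 2C`
split in `ℚ(√M)`; plus the CERTIFIED BASE `BSDp W 2`, modularity and GZK. Conclusion: `BSDp WM 2`
(and `Ш(E^{(M)})(2) = 0`, analytic rank `0`). The census word for such a pair is `TRANSPORTED:CLZ15`.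
[cite: CaiLiZhai2019, Thm. 1.1 and Thm. 1.5 (arXiv:1712.01271 §1, chunks p0003 L25–L37, p0004 L6–L13)] -/
theorem bsdp_two_twist_of_caiLiZhai (h11 : CaiLiZhai2019.thm11_ord_two_LAlg_twist) (h15 : CaiLiZhai2019.thm15_twoPartBSD_twist)
    (hmod : hasEntireLFunction_rat) (hGZK : rank_eq_analyticRank_of_analyticRank_le_one)
    (D : ModularParametrizationData W (W.conductorNorm ℤ)) (hD : CaiLiZhai2019.IsOptimalDatumWithOddManinConstant W D)
    (h2 : Nat.card {P : W.toAffine.Point // (2 : ℕ) • P = 0} = 2)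
    (hL : ∃ q : ℚ, W.entireLFunction 1 = (q : ℂ) * (W.realPeriodRat : ℂ) ∧ padicValRat 2 q = -1)
    (Q : Finset ℕ) (hQ : Q.Nonempty) (hS : ∀ q ∈ Q, CaiLiZhai2019.InS W q)
    {WM : WeierstrassCurve ℚ} [WM.IsElliptic] [WM.IsGloballyMinimal]
    (htw : ∃ C : VariableChange ℚ, C • W.quadraticTwist ((∏ q ∈ Q, q : ℕ) : ℚ) = WM)
    (W' : WeierstrassCurve ℚ) (φ : Isogeny W W') (hker : Nat.card φ.toAddMonoidHom.ker = 2)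
    (hSha' : ∀ x ∈ W'.sha, (2 : ℕ) • x = 0 → x = 0)
    (hsplit : ∀ (K : Type) [Field K] [NumberField K], Module.finrank ℚ K = 2 →
      (∃ x : K, x ^ 2 = ((∏ q ∈ Q, q : ℕ) : K)) → SatisfiesHeegnerHypothesis (2 * W.conductorNorm ℤ) K)
    (hbase : BSDp W 2) :
    WM.analyticRank = 0 ∧ AddCommGroup.primaryComponent WM.sha 2 = ⊥ ∧ BSDp WM 2 := by
  have hrW : W.analyticRank = 0 := analyticRank_eq_zero_of_ord_two_LAlg hmod hL
  have hPB : CaiLiZhai2019.pPartBSD W 2 := pPartBSD_two_of_bsdp hmod hGZK W (by omega) hbase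
  obtain ⟨hLM, -, -, -⟩ := h11 W D hD h2 hL Q hQ hS WM htw
  have hrM : WM.analyticRank = 0 := (WM.analyticRank_eq_zero_iff_holds (hmod WM)).mpr hLM
  obtain ⟨hSha, hPBM⟩ := h15 W D hD h2 hL Q hQ hS WM htw W' φ hker hSha' hsplit hPB
  exact ⟨hrM, hSha, bsdp_two_of_pPartBSD hmod hGZK WM (by omega) hPBM⟩

/-! ## §3 The family form: a closed one-parameter family inside the open rank-`0` cells -/

/-- **The Cai–Li–Zhai twist parameters of a base `E`** (as a parameter predicate for
`TwistFamilyAtTwo`): `d = ∏ Q` for a nonempty finite set `Q` of primes in `𝒮(E)` such that every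
`ℓ ∣ 2C` splits in `ℚ(√d)`. [cite: CaiLiZhai2019, Thm. 1.5 hypotheses on M (arXiv:1712.01271 chunk p0004 L6–L13)] -/
def CLZParam (W : WeierstrassCurve ℚ) [W.IsGloballyMinimal] (d : ℚ) : Prop :=
  ∃ Q : Finset ℕ, Q.Nonempty ∧ (∀ q ∈ Q, CaiLiZhai2019.InS W q) ∧ d = ((∏ q ∈ Q, q : ℕ) : ℚ) ∧
    ∀ (K : Type) [Field K] [NumberField K], Module.finrank ℚ K = 2 →
      (∃ x : K, x ^ 2 = ((∏ q ∈ Q, q : ℕ) : K)) → SatisfiesHeegnerHypothesis (2 * W.conductorNorm ℤ) K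

/-- **FAMILY FORM.** For a base `E` satisfying Cai–Li–Zhai's base-side hypotheses (optimal datum with
odd Manin constant, `#E(ℚ)[2] = 2`, `ord₂(L(E,1)/Ω_E) = −1`, `Ш(E′)[2] = 0`) whose pair `(E, 2)` is
CERTIFIED (`BSDp W 2`), the twist family `TwistFamilyAtTwo W (CLZParam W)` has its BSD-at-2
statement — granted CLZ Thm 1.1/1.5 as printed, modularity and GZK. A covered sub-family INSIDE the
open rank-`0` cells; it never recolours a cell. [cite: CaiLiZhai2019, Thm. 1.1 and Thm. 1.5] -/
theorem bsdTwoOn_twistFamily_caiLiZhai (h11 : CaiLiZhai2019.thm11_ord_two_LAlg_twist)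
    (h15 : CaiLiZhai2019.thm15_twoPartBSD_twist) (hmod : hasEntireLFunction_rat)
    (hGZK : rank_eq_analyticRank_of_analyticRank_le_one)
    (D : ModularParametrizationData W (W.conductorNorm ℤ)) (hD : CaiLiZhai2019.IsOptimalDatumWithOddManinConstant W D)
    (h2 : Nat.card {P : W.toAffine.Point // (2 : ℕ) • P = 0} = 2)
    (hL : ∃ q : ℚ, W.entireLFunction 1 = (q : ℂ) * (W.realPeriodRat : ℂ) ∧ padicValRat 2 q = -1)
    (W' : WeierstrassCurve ℚ) (φ : Isogeny W W') (hker : Nat.card φ.toAddMonoidHom.ker = 2)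
    (hSha' : ∀ x ∈ W'.sha, (2 : ℕ) • x = 0 → x = 0) (hbase : BSDp W 2) :
    BSDTwoOn (TwistFamilyAtTwo W (CLZParam W)) := by
  intro WM _ _ _ hWM
  obtain ⟨d, ⟨Q, hQ, hS, rfl, hsplit⟩, C, hC⟩ := hWM
  exact (bsdp_two_twist_of_caiLiZhai h11 h15 hmod hGZK D hD h2 hL Q hQ hS ⟨C, hC⟩ W' φ hker hSha'
    hsplit hbase).2.2

/-- **Where the family sits**: every member of the CLZ family has analytic rank `0`, i.e. rank bit
`r0` on the grid (Thm 1.1: `L(E^{(M)},1) ≠ 0`); for a non-CM base these are open O1 cells.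
[cite: CaiLiZhai2019, Thm. 1.1] -/
theorem analyticRank_eq_zero_of_twistFamily_caiLiZhai (h11 : CaiLiZhai2019.thm11_ord_two_LAlg_twist)
    (hmod : hasEntireLFunction_rat)
    (D : ModularParametrizationData W (W.conductorNorm ℤ)) (hD : CaiLiZhai2019.IsOptimalDatumWithOddManinConstant W D)
    (h2 : Nat.card {P : W.toAffine.Point // (2 : ℕ) • P = 0} = 2)
    (hL : ∃ q : ℚ, W.entireLFunction 1 = (q : ℂ) * (W.realPeriodRat : ℂ) ∧ padicValRat 2 q = -1)
    (WM : WeierstrassCurve ℚ) [WM.IsElliptic] [WM.IsGloballyMinimal]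
    (hWM : TwistFamilyAtTwo W (CLZParam W) WM) : WM.analyticRank = 0 ∧ (cellAtTwoOf WM).r1 = false := by
  obtain ⟨d, ⟨Q, hQ, hS, rfl, -⟩, C, hC⟩ := hWM
  obtain ⟨hLM, -, -, -⟩ := h11 W D hD h2 hL Q hQ hS WM ⟨C, hC⟩
  have hrM : WM.analyticRank = 0 := (WM.analyticRank_eq_zero_iff_holds (hmod WM)).mpr hLM
  refine ⟨hrM, ?_⟩
  show decide (WM.analyticRank = 1) = false
  rw [decide_eq_false_iff_not]; omega

end CLZ

/-! ## §4 Kriz–Li 2019 Thm 5.1 (2) / arXiv Thm 1.12 at `2`: pair form and the O1-schema direction -/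

/-- The two twist conventions in the tree (`C • W₁ = W.quadraticTwist d` in the Kriz–Li /
Coates–Li–Tian–Zhai files, `C • W.quadraticTwist d = W₁` in O1's `TwistTransportAtTwo` and here)
are the same relation (invert the change of variables). [folklore] -/
theorem exists_smul_eq_comm {V V' : WeierstrassCurve ℚ} :
    (∃ C : VariableChange ℚ, C • V = V') ↔ (∃ C : VariableChange ℚ, C • V' = V) :=
  ⟨fun ⟨C, h⟩ => ⟨C⁻¹, by rw [← h, inv_smul_smul]⟩, fun ⟨C, h⟩ => ⟨C⁻¹, by rw [← h, inv_smul_smul]⟩⟩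

/-- A globally minimal model of every quadratic twist exists (Néron; Silverman AEC VIII.8 Cor 8.3,
tree `hasGlobalMinimalModel_rat_holds`), in the orientation `C • E₀.quadraticTwist d = W'`.
[cite: SilvermanAEC2009, VIII.8 Cor. 8.3] -/
theorem exists_globallyMinimal_twist (V : WeierstrassCurve ℚ) [V.IsElliptic] {d : ℚ} (hd : d ≠ 0) :
    ∃ (W' : WeierstrassCurve ℚ) (_ : W'.IsElliptic) (_ : W'.IsGloballyMinimal),
      ∃ C : VariableChange ℚ, C • V.quadraticTwist d = W' := by
  haveI := V.isElliptic_quadraticTwist hd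
  obtain ⟨C, hC⟩ := hasGlobalMinimalModel_rat_holds (V.quadraticTwist d)
  exact ⟨C • V.quadraticTwist d, inferInstance, hC, C, rfl⟩

section KL

variable {W : WeierstrassCurve ℚ} [W.IsElliptic] [W.IsGloballyMinimal] [NeZero (W.conductorNorm ℤ)]

/-- **`BSD(E^{(d)}, 2)` AND `BSD(E^{(d·d_K)}, 2)` FROM TWO CERTIFIED BASES (Kriz–Li 2019 Thm 5.1 (2),
pair form).** Hypotheses VERBATIM as typed by p2-lit-2 (`KrizLi2019.thm112_bsdTwo_twist`, binders):
`E(ℚ)[2] = 0`; `K` imaginary quadratic with the Heegner hypothesis for `N`; a modular parametrisation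
datum `Dt`, Heegner datum `H`, `ι : K → ℂ`, the Heegner point `P ∈ E(K)`; an embedding
`j : K → ℚ₂` with Assumption (★); `c₂(E)` odd and, if `E` is additive at `2`, odd Manin constant;
`W₀` a globally minimal model of `E^{(d_K)}`; the TWO CERTIFIED BASES `BSDp W 2`, `BSDp W₀ 2`;
`d ∈ 𝒩` with `sign(d)·(N/|d|) = 1`; `W₁, W₂` globally minimal models of `E^{(d)}`, `E^{(d·d_K)}` (in
this file's orientation). Conclusion: `BSDp W₁ 2 ∧ BSDp W₂ 2`. Census word: `TRANSPORTED:KL51`.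
[cite: KrizLi2019, Thm. 5.1 (2) (FMS) = Thm. 1.12 (arXiv:1606.03172 p. 4)] -/
theorem bsdp_two_twists_of_krizLi (hKL : KrizLi2019.thm112_bsdTwo_twist)
    (h2 : ∀ Q : W.toAffine.Point, 2 • Q = 0 → Q = 0)
    (K : Type) [Field K] [NumberField K] (hK : IsImaginaryQuadratic K)
    (hH : SatisfiesHeegnerHypothesis (W.conductorNorm ℤ) K)
    (Dt : ModularParametrizationData W (W.conductorNorm ℤ))
    (H : HeegnerDatum (W.conductorNorm ℤ) (NumberField.discr K)) (ι : K →+* ℂ)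
    (P : (W.baseChange K).toAffine.Point)
    (hP : WeierstrassCurve.Affine.Point.map ι.toRatAlgHom P = heegnerPointComplex Dt H)
    (j : K →ₐ[ℚ] ℚ_[2]) (hstar : KrizLi2019.AssumptionStar W Dt K P j)
    (hloc : Odd ((W.baseChange ℚ_[2]).localTamagawaNumber ℤ_[2]) ∧
      (¬ W.HasGoodReductionAtPrime 2 → ¬ W.HasMultiplicativeReductionAtPrime 2 → Odd Dt.c))
    {W₀ : WeierstrassCurve ℚ} [W₀.IsElliptic] [W₀.IsGloballyMinimal]
    (hW₀ : ∃ C : VariableChange ℚ, C • W.quadraticTwist (NumberField.discr K : ℚ) = W₀)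
    (hbase : BSDp W 2) (hbase₀ : BSDp W₀ 2)
    (d : ℤ) (hd : KrizLi2019.InN W K d)
    (hsign : Int.sign d * jacobiSym (W.conductorNorm ℤ) d.natAbs = 1)
    {W₁ W₂ : WeierstrassCurve ℚ} [W₁.IsElliptic] [W₁.IsGloballyMinimal] [W₂.IsElliptic]
    [W₂.IsGloballyMinimal] (hW₁ : ∃ C : VariableChange ℚ, C • W.quadraticTwist (d : ℚ) = W₁)
    (hW₂ : ∃ C : VariableChange ℚ, C • W.quadraticTwist ((d * NumberField.discr K : ℤ) : ℚ) = W₂) :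
    BSDp W₁ 2 ∧ BSDp W₂ 2 :=
  hKL W h2 K hK hH Dt H ι P hP j hstar hloc W₀ (exists_smul_eq_comm.2 hW₀) hbase hbase₀ d hd hsign
    W₁ W₂ (exists_smul_eq_comm.2 hW₁) (exists_smul_eq_comm.2 hW₂)

/-- **The `X5.O1.TwistTransportAtTwo` DIRECTION delivered by Kriz–Li (T-5′).** O1's comparison
schema `TwistTransportAtTwo W d W₁` is the IFF `MissingPPartAt W 2 ↔ MissingPPartAt W₁ 2` (both
ranks `≤ 1`); Kriz–Li Thm 5.1 (2) prints the FORWARD half only, and with a SECOND base: under its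
hypotheses, `MissingPPartAt W 2 ∧ MissingPPartAt W₀ 2 → MissingPPartAt W₁ 2` for the `d`-twist `W₁`
(`d ∈ 𝒩`, `ψ_d(−N) = 1`). The converse half is not in print and is not claimed. (GZK `hGZK` converts
between `MissingPPartAt` and `BSDp` in analytic rank `≤ 1`; the twists have analytic rank `= r_an(E)`
by KL Thm 3.3/4.3, not used here: the rank hypothesis on `W₁` is taken as a binder, as in the schema.)
[cite: KrizLi2019, Thm. 5.1 (2) (FMS) = Thm. 1.12 (arXiv:1606.03172 p. 4)] -/
theorem missingPPartAt_twist_of_krizLi (hKL : KrizLi2019.thm112_bsdTwo_twist)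
    (hGZK : rank_eq_analyticRank_of_analyticRank_le_one)
    (h2 : ∀ Q : W.toAffine.Point, 2 • Q = 0 → Q = 0)
    (K : Type) [Field K] [NumberField K] (hK : IsImaginaryQuadratic K)
    (hH : SatisfiesHeegnerHypothesis (W.conductorNorm ℤ) K)
    (Dt : ModularParametrizationData W (W.conductorNorm ℤ))
    (H : HeegnerDatum (W.conductorNorm ℤ) (NumberField.discr K)) (ι : K →+* ℂ)
    (P : (W.baseChange K).toAffine.Point)
    (hP : WeierstrassCurve.Affine.Point.map ι.toRatAlgHom P = heegnerPointComplex Dt H)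
    (j : K →ₐ[ℚ] ℚ_[2]) (hstar : KrizLi2019.AssumptionStar W Dt K P j)
    (hloc : Odd ((W.baseChange ℚ_[2]).localTamagawaNumber ℤ_[2]) ∧
      (¬ W.HasGoodReductionAtPrime 2 → ¬ W.HasMultiplicativeReductionAtPrime 2 → Odd Dt.c))
    {W₀ : WeierstrassCurve ℚ} [W₀.IsElliptic] [W₀.IsGloballyMinimal]
    (hW₀ : ∃ C : VariableChange ℚ, C • W.quadraticTwist (NumberField.discr K : ℚ) = W₀)
    (hr : W.analyticRank ≤ 1) (hr₀ : W₀.analyticRank ≤ 1)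
    (d : ℤ) (hd : KrizLi2019.InN W K d)
    (hsign : Int.sign d * jacobiSym (W.conductorNorm ℤ) d.natAbs = 1)
    {W₁ : WeierstrassCurve ℚ} [W₁.IsElliptic] [W₁.IsGloballyMinimal]
    (hW₁ : ∃ C : VariableChange ℚ, C • W.quadraticTwist (d : ℚ) = W₁) (hr₁ : W₁.analyticRank ≤ 1)
    (hm : MissingPPartAt W 2) (hm₀ : MissingPPartAt W₀ 2) : MissingPPartAt W₁ 2 := by
  -- a globally minimal model of the companion twist `E^{(d·d_K)}` exists (its conclusion is dropped)
  have hdK : ((d * NumberField.discr K : ℤ) : ℚ) ≠ 0 := by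
    have hd0 : d ≠ 0 := by
      rintro rfl
      simp at hsign
    have hD0 : NumberField.discr K ≠ 0 := NumberField.discr_ne_zero K
    exact_mod_cast mul_ne_zero hd0 hD0
  obtain ⟨W₂, _, _, hW₂⟩ := exists_globallyMinimal_twist W hdK
  haveI : Finite W₁.sha := (hGZK W₁ hr₁).2
  exact missingPPartAt_of_bsdp W₁ 2
    (bsdp_two_twists_of_krizLi hKL h2 K hK hH Dt H ι P hP j hstar hloc hW₀
      (bsdp_of_missingPPartAt W 2 hGZK hr hm) (bsdp_of_missingPPartAt W₀ 2 hGZK hr₀ hm₀)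
      d hd hsign hW₁ hW₂).1

end KL

end Summit.BirchSwinnertonDyer.Rank1Residual.P2

end
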